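import Literature.Probability.LatticeModels.DiscreteDualBoundaryTrace
import Literature.Probability.LatticeModels.DiscreteRectArcShrinking
import Literature.Probability.LatticeModels.RWPartitionFunctionExtremalLengthBound
import HarnessLib

/-!
# The interior dual of a discrete topological rectangle is a topological rectangle

Topic `Literature/Probability/LatticeModels` (family `crit-ising`); support for the dual side of the printed proof of
CDH16 Thm. 1.1 (`fkIsing_topologicalRectangle_crossingBounds`, §4: duality `Ω ↔ Ω*`, Cor. 4.4, (3.8)). In the
vocabulary of `DiscreteRectBoundaryTrace.lean` (`slots`, `gen`, `succ`, `quad`, `InF`, `faces`, `lsq`/`rsq`),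
`DiscreteDualDomain.lean` (`dualInt E = Ω*_int`, `dualDart`) and `DiscreteDualBoundaryTrace.lean` (`IsFaceDomain`,
`NoPinchAt`, `nextArrow`, the local step `succ_dualInt_dualDart`), this file assembles the global statement:

* `DiscreteRect.slotList E d` / `DiscreteRect.walkedList E d₀ i` — the arrows walked by the segment of a dart / by the
  first `i` darts of the boundary cycle, as lists (list forms of `slots`); `DiscreteRect.firstArrow E d` — the first
  arrow walked at or after `d`;
* **the trace follows the right-hand rule** (`slotList_chain`, `nextArrow_getLast`, `walkedList_invariant`): the walked
  arrows form a `nextArrow`-chain which closes up after one period;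
* **no repetition and exhaustion** (`IsRect.nodup_walkedList`, `IsRect.mem_walkedList`): in one period every arrow of
  `E` with an exterior right square is walked exactly once;
* **`DiscreteRect.IsRect.dual`**: for a rectangle `IsRect E d₀ n` on a face domain without pinch points, in which every
  face has a neighbouring face and each of whose four arcs walks at least one arrow, the interior dual `dualInt E` with
  first dart `dualDart (firstArrow E d₀)` and arc sizes `dualCount E d₀ n` (the numbers of arrows walked by the four
  arcs) is again an `IsRect`; its boundary cycle is `t ↦ dualDart (walkedList E d₀ N)[t]` (`IsRect.iterate_succ_dualInt`),
  and its arcs are identified in `IsRect.extArc_dual` / `IsRect.arcVerts_dual` (CDH16 §3.3: the dual arcs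
  `(a* b*), (b* c*), (c* d*), (d* a*)`).

## References
* [ChelkakDuminilCopinHongler2016] D. Chelkak, H. Duminil-Copin, C. Hongler, EJP 21 (2016) no. 5, §2.1 (cyclic
  order on `∂Ω`), §2.5 (`Ω*_int`), §3.3 (dual arcs, `x*`).
-/

noncomputable section

open SimpleGraph Finset

namespace Literature.Probability.LatticeModels

namespace DiscreteRect

variable {E : Finset (Sym2 (Site 2))}

/-! ### Segments as lists and the first arrow of a dart -/

/-- The arrows walked from the external dart `d` to `succ E d`, in order (the list form of `slots E d`).
[folklore] -/
def slotList (E : Finset (Sym2 (Site 2))) (d : Site 2 × Fin 4) : List (Site 2 × Fin 4) :=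
  if s(d.1, d.1 + dir (d.2 + 1)) ∈ E then
    if s(d.1 + dir (d.2 + 1), d.1 + dir (d.2 + 1) + dir d.2) ∈ E then
      if s(d.1 + dir (d.2 + 1) + dir d.2, d.1 + dir (d.2 + 1) + dir d.2 + dir (d.2 - 1)) ∈ E then
        [(d.1, d.2 + 1), (d.1 + dir (d.2 + 1), d.2), (d.1 + dir (d.2 + 1) + dir d.2, d.2 - 1)]
      else [(d.1, d.2 + 1), (d.1 + dir (d.2 + 1), d.2)]
    else [(d.1, d.2 + 1)]
  else []

/-- **The first arrow walked at or after the dart `d = (x, k)`**: `(x, k+1)` along `xx'` if `xx' ∈ E`, else (the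
dart only turns, and in a face domain the next dart leaves `x`) `(x, k+2)`. [folklore] -/
def firstArrow (E : Finset (Sym2 (Site 2))) (d : Site 2 × Fin 4) : Site 2 × Fin 4 :=
  if s(d.1, d.1 + dir (d.2 + 1)) ∈ E then (d.1, d.2 + 1) else (d.1, d.2 + 2)

/-- The list form of a segment has the same arrows as `slots`. [folklore] -/
theorem mem_slotList_iff {d a : Site 2 × Fin 4} : a ∈ slotList E d ↔ a ∈ slots E d := by
  rw [mem_slots_iff]
  unfold slotList
  split_ifs with h1 h2 h3
  · simp [h1, h2, h3]
  · simp [h1, h2, h3]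
  · simp [h1, h2]
  · simp [h1]

/-- A segment has at most three arrows. [folklore] -/
theorem length_slotList_le (d : Site 2 × Fin 4) : (slotList E d).length ≤ 3 := by
  unfold slotList
  split_ifs <;> simp

/-- The arrows of a segment are distinct. [folklore] -/
theorem nodup_slotList (d : Site 2 × Fin 4) : (slotList E d).Nodup := by
  have hne1 : (d.1, d.2 + 1) ≠ (d.1 + dir (d.2 + 1), d.2) := by
    intro h; have := congrArg Prod.fst h; exact absurd this.symm (add_dir_ne _ _)
  have hne2 : (d.1, d.2 + 1) ≠ (d.1 + dir (d.2 + 1) + dir d.2, d.2 - 1) := by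
    intro h
    have h2 := congrArg Prod.snd h
    simp only at h2
    have : ∀ k : Fin 4, k + 1 ≠ k - 1 := by decide
    exact this _ h2
  have hne3 : (d.1 + dir (d.2 + 1), d.2) ≠ (d.1 + dir (d.2 + 1) + dir d.2, d.2 - 1) := by
    intro h; have := congrArg Prod.fst h; exact absurd this.symm (add_dir_ne _ _)
  unfold slotList
  split_ifs <;> simp [hne1, hne2, hne3]

/-- The other side of a face at a corner: `InF (quad x j)` gives the edge from `x` in direction `e_{j+1}`.
[folklore] -/
theorem mem_add_one_of_inF_quad {x : Site 2} {j : Fin 4} (h : InF E (quad x j)) : s(x, x + dir (j + 1)) ∈ E := by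
  have := h.side_mem (j + 3)
  rw [corner_quad_add_three, dir_add_three, ← sub_eq_add_neg, add_sub_cancel_right, Sym2.eq_swap] at this
  exact this

/-- A vertex of a lattice domain has an edge in one of the four directions. [folklore] -/
theorem exists_mem_dir_of_mem_verts (hE : ∀ e ∈ E, e ∈ (zdGraph 2).edgeSet) {x : Site 2} (hx : x ∈ verts E) :
    ∃ j : Fin 4, s(x, x + dir j) ∈ E := by
  classical
  simp only [verts, Finset.mem_biUnion] at hx
  obtain ⟨e, he, hxe⟩ := hx
  induction e using Sym2.ind with
  | h a b =>
    have hab : (zdGraph 2).Adj a b := by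
      have := hE _ he
      rwa [SimpleGraph.mem_edgeSet] at this
    simp only [endpts, Sym2.lift_mk, Finset.mem_insert, Finset.mem_singleton] at hxe
    -- the other endpoint `w` with `s(x, w) ∈ E` and `x ∼ w`
    obtain ⟨w, hw, hadj⟩ : ∃ w, s(x, w) ∈ E ∧ (zdGraph 2).Adj x w := by
      rcases hxe with rfl | rfl
      · exact ⟨b, he, hab⟩
      · exact ⟨a, by rw [Sym2.eq_swap]; exact he, hab.symm⟩
    have hadj' : (fromEdgeSet (↑E : Set (Sym2 (Site 2)))).Adj x w := by
      rw [fromEdgeSet_adj]; exact ⟨hw, hadj.ne⟩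
    have hmem := mem_image_add_dir_of_adj hE hadj'
    rw [Finset.mem_image] at hmem
    obtain ⟨j, -, rfl⟩ := hmem
    exact ⟨j, hw⟩

/-- **No dead ends in a face domain**: at an external dart `(x, k)` which only turns (`xx' ∉ E`,
`x' = x + e_{k+1}`), the edge in direction `e_{k+2}` is present — so at most one turn in a row. [folklore] -/
theorem mem_add_two_of_turn (hE : ∀ e ∈ E, e ∈ (zdGraph 2).edgeSet) (hF : IsFaceDomain E) {x : Site 2} {k : Fin 4}
    (hd : IsExtDart E (x, k)) (h1 : s(x, x + dir (k + 1)) ∉ E) : s(x, x + dir (k + 2)) ∈ E := by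
  have k1 : ∀ k : Fin 4, k + 3 + 1 = k := by decide
  have k2 : ∀ k : Fin 4, k + 3 + 3 = k + 2 := by decide
  obtain ⟨j, hj⟩ := exists_mem_dir_of_mem_verts hE hd.1
  have hjk : j ≠ k := fun h ↦ hd.2 (h ▸ hj)
  have hjk1 : j ≠ k + 1 := fun h ↦ h1 (h ▸ hj)
  by_cases hjk2 : j = k + 2
  · exact hjk2 ▸ hj
  · have hjk3 : j = k + 3 := by
      fin_cases j <;> fin_cases k <;> simp_all (config := {decide := true})
    subst hjk3
    rcases hF (x, k + 3) hj with h | h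
    · rw [lsq_mk] at h
      have := mem_add_one_of_inF_quad h
      rw [k1] at this
      exact absurd this hd.2
    · rw [rsq_mk, k2] at h
      exact mem_of_inF_quad h

/-- If `xx' ∈ E` the first arrow of the dart `(x, k)` is `(x, k+1)`, the head of its segment. [folklore] -/
theorem firstArrow_of_mem {d : Site 2 × Fin 4} (h1 : s(d.1, d.1 + dir (d.2 + 1)) ∈ E) :
    firstArrow E d = (d.1, d.2 + 1) := by
  simp [firstArrow, h1]

/-- A turning dart has the same first arrow as its successor. [folklore] -/
theorem firstArrow_of_notMem (hE : ∀ e ∈ E, e ∈ (zdGraph 2).edgeSet) (hF : IsFaceDomain E) {d : Site 2 × Fin 4}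
    (hd : IsExtDart E d) (h1 : s(d.1, d.1 + dir (d.2 + 1)) ∉ E) :
    firstArrow E d = firstArrow E (succ E d) ∧ succ E d = (d.1, d.2 + 1) ∧ slotList E d = [] := by
  obtain ⟨x, k⟩ := d
  have k1 : ∀ k : Fin 4, k + 1 + 1 = k + 2 := by decide
  have hsucc : succ E (x, k) = (x, k + 1) := by simp [succ, h1]
  have h2 := mem_add_two_of_turn hE hF hd h1
  refine ⟨?_, hsucc, by simp [slotList, h1]⟩
  rw [hsucc]
  simp [firstArrow, h1, k1, h2]

/-- **Within a segment the trace turns right**: consecutive arrows of `slotList E d` follow the right-hand rule.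
[folklore] -/
theorem slotList_chain (d : Site 2 × Fin 4) : (slotList E d).IsChain (fun a b ↦ b = nextArrow E a) := by
  have k1 : ∀ k : Fin 4, k + 1 + 3 = k := by decide
  have k2 : ∀ k : Fin 4, k + 3 = k - 1 := by decide
  unfold slotList
  split_ifs with h1 h2 h3
  · -- three arrows
    refine List.isChain_cons_cons.2 ⟨?_, List.isChain_cons_cons.2 ⟨?_, List.isChain_singleton _⟩⟩
    · simp [nextArrow, k1, h2]
    · simp [nextArrow, k2, h3]
  · refine List.isChain_cons_cons.2 ⟨?_, List.isChain_singleton _⟩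
    simp [nextArrow, k1, h2]
  · exact List.isChain_singleton _
  · exact List.isChain_nil

/-- **Across segments**: the right-hand rule applied to the last arrow of the segment of `d` gives the first arrow
walked at or after `succ E d`. [folklore] -/
theorem nextArrow_getLast (hE : ∀ e ∈ E, e ∈ (zdGraph 2).edgeSet) (hF : IsFaceDomain E) {d : Site 2 × Fin 4}
    (hd : IsExtDart E d) (hne : slotList E d ≠ []) :
    nextArrow E ((slotList E d).getLast hne) = firstArrow E (succ E d) := by
  obtain ⟨x, k⟩ := d
  have k1 : ∀ k : Fin 4, k + 1 + 3 = k := by decide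
  have k2 : ∀ k : Fin 4, k + 3 = k - 1 := by decide
  have k3 : ∀ k : Fin 4, k + 1 + 1 = k + 2 := by decide
  have k4 : ∀ k : Fin 4, k - 1 + 3 = k + 2 := by decide
  have k5 : ∀ k : Fin 4, k - 1 + 1 = k := by decide
  have k6 : ∀ k : Fin 4, k - 1 + 2 = k + 1 := by decide
  have k7 : ∀ k : Fin 4, k - 2 = k + 2 := by decide
  have hsd := hd.succ
  by_cases h1 : s(x, x + dir (k + 1)) ∈ E
  · by_cases h2 : s(x + dir (k + 1), x + dir (k + 1) + dir k) ∈ E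
    · by_cases h3 : s(x + dir (k + 1) + dir k, x + dir (k + 1) + dir k + dir (k - 1)) ∈ E
      · -- three arrows, `succ d` is the reversed dart `(x + e_{k+1} + e_k + e_{k-1}, k - 2)`
        have hsucc : succ E (x, k) = (x + dir (k + 1) + dir k + dir (k - 1), k - 2) := by simp [succ, h1, h2, h3]
        have hsl : slotList E (x, k) = [(x, k + 1), (x + dir (k + 1), k), (x + dir (k + 1) + dir k, k - 1)] := by
          simp [slotList, h1, h2, h3]
        rw [hsucc] at hsd ⊢
        simp only [hsl, List.getLast_cons_cons, List.getLast_singleton]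
        -- the right turn from `(z, k-1)` would be along the missing edge of `succ d`
        have hR : s(x + dir (k + 1) + dir k + dir (k - 1), x + dir (k + 1) + dir k + dir (k - 1) + dir (k - 1 + 3)) ∉ E := by
          rw [k4, ← k7]; exact hsd.2
        by_cases hS : s(x + dir (k + 1) + dir k + dir (k - 1), x + dir (k + 1) + dir k + dir (k - 1) + dir (k - 1)) ∈ E
        · have : firstArrow E (x + dir (k + 1) + dir k + dir (k - 1), k - 2) =
              (x + dir (k + 1) + dir k + dir (k - 1), k - 1) := by
            simp [firstArrow, k7, show ∀ k : Fin 4, k + 2 + 1 = k - 1 by decide, hS]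
          rw [this]; simp [nextArrow, hR, hS]
        · have hL := mem_add_two_of_turn hE hF hsd (by rw [k7, show ∀ k : Fin 4, k + 2 + 1 = k - 1 by decide]; exact hS)
          rw [k7, show ∀ k : Fin 4, k + 2 + 2 = k by decide] at hL
          have : firstArrow E (x + dir (k + 1) + dir k + dir (k - 1), k - 2) =
              (x + dir (k + 1) + dir k + dir (k - 1), k) := by
            simp [firstArrow, k7, show ∀ k : Fin 4, k + 2 + 1 = k - 1 by decide, hS, show ∀ k : Fin 4, k + 2 + 2 = k by decide]
          rw [this]; simp [nextArrow, hR, hS, k5, hL]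
      · -- two arrows, `succ d = (x + e_{k+1} + e_k, k - 1)`
        have hsucc : succ E (x, k) = (x + dir (k + 1) + dir k, k - 1) := by simp [succ, h1, h2, h3]
        have hsl : slotList E (x, k) = [(x, k + 1), (x + dir (k + 1), k)] := by simp [slotList, h1, h2, h3]
        rw [hsucc] at hsd ⊢
        simp only [hsl, List.getLast_cons_cons, List.getLast_singleton]
        have hR : s(x + dir (k + 1) + dir k, x + dir (k + 1) + dir k + dir (k + 3)) ∉ E := by rw [k2]; exact h3
        by_cases hS : s(x + dir (k + 1) + dir k, x + dir (k + 1) + dir k + dir k) ∈ E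
        · have : firstArrow E (x + dir (k + 1) + dir k, k - 1) = (x + dir (k + 1) + dir k, k) := by
            simp [firstArrow, k5, hS]
          rw [this]; simp [nextArrow, hR, hS]
        · have hL := mem_add_two_of_turn hE hF hsd (by rw [k5]; exact hS)
          rw [k6] at hL
          have : firstArrow E (x + dir (k + 1) + dir k, k - 1) = (x + dir (k + 1) + dir k, k + 1) := by
            simp [firstArrow, k5, hS, k6]
          rw [this]; simp [nextArrow, hR, hS, hL]
    · -- one arrow, `succ d = (x + e_{k+1}, k)`
      have hsucc : succ E (x, k) = (x + dir (k + 1), k) := by simp [succ, h1, h2]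
      have hsl : slotList E (x, k) = [(x, k + 1)] := by simp [slotList, h1, h2]
      rw [hsucc] at hsd ⊢
      simp only [hsl, List.getLast_singleton]
      have hR : s(x + dir (k + 1), x + dir (k + 1) + dir (k + 1 + 3)) ∉ E := by rw [k1]; exact h2
      by_cases hS : s(x + dir (k + 1), x + dir (k + 1) + dir (k + 1)) ∈ E
      · have : firstArrow E (x + dir (k + 1), k) = (x + dir (k + 1), k + 1) := by simp [firstArrow, hS]
        rw [this]; simp [nextArrow, hR, hS]
      · have hL := mem_add_two_of_turn hE hF hsd hS
        have : firstArrow E (x + dir (k + 1), k) = (x + dir (k + 1), k + 2) := by simp [firstArrow, hS]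
        rw [this]; simp [nextArrow, hR, hS, hL, k3]
  · exact absurd (by simp [slotList, h1] : slotList E (x, k) = []) hne

/-! ### The walked arrows of a boundary cycle, as a list -/

/-- The arrows walked by the first `i` darts of the boundary-tracing orbit of `d₀`, in order.
[folklore] -/
def walkedList (E : Finset (Sym2 (Site 2))) (d₀ : Site 2 × Fin 4) : ℕ → List (Site 2 × Fin 4)
  | 0 => []
  | i + 1 => walkedList E d₀ i ++ slotList E ((succ E)^[i] d₀)

/-- Membership: an arrow of the list is an arrow of the segment of one of the first `i` darts. [folklore] -/
theorem mem_walkedList_iff {d₀ a : Site 2 × Fin 4} {i : ℕ} :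
    a ∈ walkedList E d₀ i ↔ ∃ i' < i, a ∈ slotList E ((succ E)^[i'] d₀) := by
  induction i with
  | zero => simp [walkedList]
  | succ i ih =>
    simp only [walkedList, List.mem_append, ih]
    constructor
    · rintro (⟨i', hi', h⟩ | h)
      · exact ⟨i', by omega, h⟩
      · exact ⟨i, by omega, h⟩
    · rintro ⟨i', hi', h⟩
      by_cases hii : i' = i
      · subst hii; exact Or.inr h
      · exact Or.inl ⟨i', by omega, h⟩

/-- Length: the number of arrows walked by the first `i` darts. [folklore] -/
theorem length_walkedList (d₀ : Site 2 × Fin 4) (i : ℕ) :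
    (walkedList E d₀ i).length = ∑ i' ∈ Finset.range i, (slotList E ((succ E)^[i'] d₀)).length := by
  induction i with
  | zero => simp [walkedList]
  | succ i ih => rw [walkedList, List.length_append, ih, Finset.sum_range_succ]

/-- **The walked arrows follow the right-hand rule** (invariants of the list): it is a `nextArrow`-chain, its head
is the first arrow of `d₀`, and the right-hand rule applied to its last arrow gives the first arrow of the current
dart. [folklore] -/
theorem walkedList_invariant (hE : ∀ e ∈ E, e ∈ (zdGraph 2).edgeSet) (hF : IsFaceDomain E) {d₀ : Site 2 × Fin 4}
    (hd₀ : IsExtDart E d₀) (i : ℕ) :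
    (walkedList E d₀ i).IsChain (fun a b ↦ b = nextArrow E a) ∧
      (walkedList E d₀ i = [] → firstArrow E ((succ E)^[i] d₀) = firstArrow E d₀) ∧
      (∀ hne : walkedList E d₀ i ≠ [],
        (walkedList E d₀ i).head hne = firstArrow E d₀ ∧
          nextArrow E ((walkedList E d₀ i).getLast hne) = firstArrow E ((succ E)^[i] d₀)) := by
  induction i with
  | zero => exact ⟨List.isChain_nil, fun _ ↦ rfl, fun hne ↦ absurd rfl hne⟩
  | succ i ih =>
    obtain ⟨ihc, ihe, ihne⟩ := ih
    have hdi : IsExtDart E ((succ E)^[i] d₀) := hd₀.iterate i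
    have hsucc : (succ E)^[i + 1] d₀ = succ E ((succ E)^[i] d₀) := Function.iterate_succ_apply' _ _ _
    simp only [walkedList]
    by_cases h1 : s(((succ E)^[i] d₀).1, ((succ E)^[i] d₀).1 + dir (((succ E)^[i] d₀).2 + 1)) ∈ E
    · -- a nonempty segment is appended
      have hS : slotList E ((succ E)^[i] d₀) ≠ [] := by
        unfold slotList; simp only [h1, if_true]; split_ifs <;> simp
      have hShead : (slotList E ((succ E)^[i] d₀)).head hS = firstArrow E ((succ E)^[i] d₀) := by
        rw [firstArrow_of_mem h1]
        unfold slotList; simp only [h1, if_true]; split_ifs <;> rfl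
      refine ⟨?_, fun h ↦ absurd (List.append_eq_nil_iff.1 h).2 hS, fun hne ↦ ⟨?_, ?_⟩⟩
      · refine List.IsChain.append ihc (slotList_chain _) fun x hx y hy ↦ ?_
        by_cases hL : walkedList E d₀ i = []
        · simp [hL] at hx
        · rw [List.getLast?_eq_some_getLast hL, Option.mem_def, Option.some.injEq] at hx
          rw [List.head?_eq_some_head hS, Option.mem_def, Option.some.injEq] at hy
          rw [← hx, ← hy, hShead]
          exact ((ihne hL).2).symm
      · by_cases hL : walkedList E d₀ i = []
        · rw [List.head_append_right hne hL, hShead]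
          exact ihe hL
        · rw [List.head_append_of_ne_nil hL]
          exact (ihne hL).1
      · rw [List.getLast_append_of_ne_nil hne hS, hsucc]
        exact nextArrow_getLast hE hF hdi hS
    · -- the dart only turns
      obtain ⟨hfa, -, hsl⟩ := firstArrow_of_notMem hE hF hdi h1
      refine ⟨?_, fun h ↦ ?_, fun hne ↦ ?_⟩
      · rw [hsl, List.append_nil]; exact ihc
      · rw [hsl, List.append_nil] at h
        rw [hsucc, ← hfa]; exact ihe h
      · have hne' : walkedList E d₀ i ≠ [] := by rwa [hsl, List.append_nil] at hne
        constructor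
        · simp only [hsl, List.append_nil]; exact (ihne hne').1
        · simp only [hsl, List.append_nil]; rw [hsucc, ← hfa]; exact (ihne hne').2

/-- **Shifting the start**: the arrows walked by `i + i'` darts are those walked by the first `i` darts followed by
those walked by the next `i'`. [folklore] -/
theorem walkedList_add (d₀ : Site 2 × Fin 4) (i i' : ℕ) :
    walkedList E d₀ (i + i') = walkedList E d₀ i ++ walkedList E ((succ E)^[i] d₀) i' := by
  induction i' with
  | zero => simp [walkedList]
  | succ i' ih =>
    rw [← Nat.add_assoc]
    simp only [walkedList]
    rw [ih, List.append_assoc, ← Function.iterate_add_apply, Nat.add_comm i' i]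

/-- A walked arrow is an edge of `E` with an exterior square on its right. [folklore] -/
theorem aedge_mem_of_mem_walkedList {d₀ a : Site 2 × Fin 4} (hd₀ : IsExtDart E d₀) {i : ℕ}
    (ha : a ∈ walkedList E d₀ i) : aedge a ∈ E ∧ ¬ InF E (rsq a) := by
  obtain ⟨i', -, ha'⟩ := mem_walkedList_iff.1 ha
  rw [mem_slotList_iff] at ha'
  refine ⟨aedge_mem_of_mem_slots ha', ?_⟩
  rw [rsq_of_mem_slots ha']
  exact not_inF_quad (hd₀.iterate i').2

/-- In a face domain a walked arrow has a face on its left. [folklore] -/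
theorem inF_lsq_of_mem_walkedList (hF : IsFaceDomain E) {d₀ a : Site 2 × Fin 4} (hd₀ : IsExtDart E d₀) {i : ℕ}
    (ha : a ∈ walkedList E d₀ i) : InF E (lsq a) := by
  obtain ⟨h1, h2⟩ := aedge_mem_of_mem_walkedList hd₀ ha
  exact (hF a h1).resolve_right h2

/-- **One step of the dual trace at a walked arrow** (`succ_dualInt_dualDart` with its side conditions
discharged). [folklore] -/
theorem succ_dualInt_dualDart_of_mem_walkedList (hF : IsFaceDomain E) (hP : ∀ q, NoPinchAt E q)
    {d₀ a : Site 2 × Fin 4} (hd₀ : IsExtDart E d₀) {i : ℕ} (ha : a ∈ walkedList E d₀ i) :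
    succ (dualInt E) (dualDart a) = dualDart (nextArrow E a) := by
  obtain ⟨p, m⟩ := a
  obtain ⟨h1, h2⟩ := aedge_mem_of_mem_walkedList hd₀ ha
  exact succ_dualInt_dualDart hF (hP _) ((hF _ h1).resolve_right h2) h2

/-- A chain for the relation `b = f a` lists the iterates of `f` applied to its head. [folklore] -/
theorem getElem_eq_iterate_of_isChain {α : Type*} {f : α → α} {l : List α}
    (h : l.IsChain (fun a b ↦ b = f a)) {t : ℕ} (ht : t < l.length) :
    l[t] = f^[t] (l[0]'(by omega)) := by
  induction t with
  | zero => rfl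
  | succ t ih =>
    rw [List.isChain_iff_getElem.1 h t ht, ih (by omega), ← Function.iterate_succ_apply' f t]

/-- Dual darts determine their arrows. [folklore] -/
theorem dualDart_injective : Function.Injective dualDart := by
  rintro ⟨p, m⟩ ⟨p', m'⟩ h
  simp only [dualDart, lsq_mk, Prod.mk.injEq, add_left_inj] at h
  obtain ⟨h1, rfl⟩ := h
  have := congrArg (fun s ↦ corner s m) h1
  simp only [corner_quad] at this
  rw [this]

/-- **The dual dart of a walked arrow is an external dart of `Ω*_int`** (when every face of `Ω` is a vertex
of `Ω*_int`): its base `lsq a` is a face and it points to the exterior square `rsq a`. [folklore] -/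
theorem isExtDart_dualInt_dualDart (hiso : ∀ f ∈ faces E, f ∈ verts (dualInt E)) {a : Site 2 × Fin 4}
    (hl : InF E (lsq a)) (hr : ¬ InF E (rsq a)) : IsExtDart (dualInt E) (dualDart a) := by
  obtain ⟨p, m⟩ := a
  refine ⟨hiso _ (mem_faces.2 hl), fun h ↦ hr ?_⟩
  simp only [dualDart, lsq_mk, quad_add_dir_add_three] at h
  exact mem_faces.1 (mem_faces_of_mem_dualInt h).2

section Rect

variable {d₀ : Site 2 × Fin 4} {n : Fin 4 → ℕ}

/-- **No arrow is walked twice** in one period of the boundary cycle of a rectangle. [folklore] -/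
theorem IsRect.nodup_walkedList (hR : IsRect E d₀ n) {i : ℕ} (hi : i ≤ n 0 + n 1 + n 2 + n 3) :
    (walkedList E d₀ i).Nodup := by
  induction i with
  | zero => exact List.nodup_nil
  | succ i ih =>
    rw [walkedList, List.nodup_append]
    refine ⟨ih (by omega), nodup_slotList _, fun a ha b hb hab ↦ ?_⟩
    subst hab
    obtain ⟨i', hi', ha'⟩ := mem_walkedList_iff.1 ha
    rw [mem_slotList_iff] at ha' hb
    have h1 := gen_eq_of_mem_slots (hR.isExtDart_iterate i').2 ha'
    have h2 := gen_eq_of_mem_slots (hR.isExtDart_iterate i).2 hb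
    have := hR.injOn i' i (by omega) (by omega) (h1.symm.trans h2)
    omega

/-- **Every arrow of `E` with an exterior right square is walked** in one period of the boundary cycle.
[folklore] -/
theorem IsRect.mem_walkedList (hR : IsRect E d₀ n) {a : Site 2 × Fin 4} (ha : aedge a ∈ E)
    (hr : ¬ InF E (rsq a)) : a ∈ walkedList E d₀ (n 0 + n 1 + n 2 + n 3) := by
  obtain ⟨i, hi, hgen⟩ := hR.cover _ (isExtDart_gen ha hr)
  exact mem_walkedList_iff.2 ⟨i, hi, mem_slotList_iff.2 (hgen ▸ mem_slots_gen ha)⟩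

/-- **The dual boundary cycle follows the walked arrows**: the `t`-th dart of the boundary trace of `Ω*_int`
started at the dual dart of the first arrow is the dual dart of the `t`-th walked arrow. [folklore] -/
theorem IsRect.iterate_succ_dualInt (hR : IsRect E d₀ n) (hF : IsFaceDomain E) (hP : ∀ q, NoPinchAt E q)
    {t : ℕ} (ht : t < (walkedList E d₀ (n 0 + n 1 + n 2 + n 3)).length) :
    (succ (dualInt E))^[t] (dualDart (firstArrow E d₀)) =
      dualDart ((walkedList E d₀ (n 0 + n 1 + n 2 + n 3))[t]) := by
  have hne : walkedList E d₀ (n 0 + n 1 + n 2 + n 3) ≠ [] := List.ne_nil_of_length_pos (by omega)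
  obtain ⟨hc, -, hinv⟩ := walkedList_invariant hR.subset_edgeSet hF hR.isExtDart (n 0 + n 1 + n 2 + n 3)
  induction t with
  | zero => rw [Function.iterate_zero, id_eq, ← (hinv hne).1, List.head_eq_getElem]
  | succ t ih =>
    rw [Function.iterate_succ_apply', ih (by omega),
      succ_dualInt_dualDart_of_mem_walkedList hF hP hR.isExtDart (List.getElem_mem _),
      List.isChain_iff_getElem.1 hc t ht]

/-- **The dual boundary cycle closes up** after all walked arrows. [folklore] -/
theorem IsRect.iterate_succ_dualInt_length (hR : IsRect E d₀ n) (hF : IsFaceDomain E) (hP : ∀ q, NoPinchAt E q) :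
    (succ (dualInt E))^[(walkedList E d₀ (n 0 + n 1 + n 2 + n 3)).length] (dualDart (firstArrow E d₀)) =
      dualDart (firstArrow E d₀) := by
  rcases Nat.eq_zero_or_pos (walkedList E d₀ (n 0 + n 1 + n 2 + n 3)).length with h0 | hpos
  · rw [h0, Function.iterate_zero, id_eq]
  · have hne : walkedList E d₀ (n 0 + n 1 + n 2 + n 3) ≠ [] := List.ne_nil_of_length_pos hpos
    obtain ⟨-, -, hinv⟩ := walkedList_invariant hR.subset_edgeSet hF hR.isExtDart (n 0 + n 1 + n 2 + n 3)
    obtain ⟨M, hM⟩ := Nat.exists_eq_add_one_of_ne_zero (by omega : (walkedList E d₀ (n 0 + n 1 + n 2 + n 3)).length ≠ 0)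
    have hlast : (walkedList E d₀ (n 0 + n 1 + n 2 + n 3))[M]'(by omega) =
        (walkedList E d₀ (n 0 + n 1 + n 2 + n 3)).getLast hne := by
      rw [List.getLast_eq_getElem]; congr 1; omega
    rw [hM, Function.iterate_succ_apply', hR.iterate_succ_dualInt hF hP (by omega),
      succ_dualInt_dualDart_of_mem_walkedList hF hP hR.isExtDart (List.getElem_mem _), hlast, (hinv hne).2,
      hR.periodic]

/-- **The arc sizes of the dual rectangle**: arc `j` of `Ω*_int` consists of the dual darts of the arrows walked
by the darts of arc `j` of `Ω`. [folklore] -/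
def dualCount (E : Finset (Sym2 (Site 2))) (d₀ : Site 2 × Fin 4) (n : Fin 4 → ℕ) (j : Fin 4) : ℕ :=
  (walkedList E ((succ E)^[lo n j] d₀) (n j)).length

/-- The offsets of the dual arcs are the numbers of arrows walked before the arcs of `Ω`. [folklore] -/
theorem lo_dualCount (d₀ : Site 2 × Fin 4) (n : Fin 4 → ℕ) (j : Fin 4) :
    lo (dualCount E d₀ n) j = (walkedList E d₀ (lo n j)).length := by
  fin_cases j
  · simp [lo, walkedList]
  · simp [lo, dualCount]
  · simp [lo, dualCount, walkedList_add]
  · simp [lo, dualCount, walkedList_add]; omega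

/-- The period of the dual cycle is the number of walked arrows. [folklore] -/
theorem sum_dualCount (d₀ : Site 2 × Fin 4) (n : Fin 4 → ℕ) :
    dualCount E d₀ n 0 + dualCount E d₀ n 1 + dualCount E d₀ n 2 + dualCount E d₀ n 3 =
      (walkedList E d₀ (n 0 + n 1 + n 2 + n 3)).length := by
  simp [lo, dualCount, walkedList_add]; omega

/-- **The interior dual of a rectangle is a rectangle** (CDH16 §2.5/§3.3: the dual darts of the arrows of
`∂Ω`, in the order they are walked, form the boundary cycle of `Ω*_int`, cut into the four dual arcs): for a
face domain without pinch points in which every face has a neighbouring face, and whose four arcs each walk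
at least one arrow. [cite: ChelkakDuminilCopinHongler2016, §2.5] -/
theorem IsRect.dual (hR : IsRect E d₀ n) (hF : IsFaceDomain E) (hP : ∀ q, NoPinchAt E q)
    (hiso : ∀ f ∈ faces E, f ∈ verts (dualInt E)) (hpos : ∀ j, 0 < dualCount E d₀ n j) :
    IsRect (dualInt E) (dualDart (firstArrow E d₀)) (dualCount E d₀ n) := by
  have hlen : 0 < (walkedList E d₀ (n 0 + n 1 + n 2 + n 3)).length := by
    rw [← sum_dualCount]; have := hpos 3; omega
  have hne : walkedList E d₀ (n 0 + n 1 + n 2 + n 3) ≠ [] := List.ne_nil_of_length_pos hlen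
  obtain ⟨-, -, hinv⟩ := walkedList_invariant hR.subset_edgeSet hF hR.isExtDart (n 0 + n 1 + n 2 + n 3)
  refine ⟨dualInt_subset_edgeSet, ?_, hpos, ?_, ?_, ?_⟩
  · -- the first arrow is walked
    have hmem : firstArrow E d₀ ∈ walkedList E d₀ (n 0 + n 1 + n 2 + n 3) := by
      rw [← (hinv hne).1]; exact List.head_mem hne
    obtain ⟨h1, h2⟩ := aedge_mem_of_mem_walkedList hR.isExtDart hmem
    exact isExtDart_dualInt_dualDart hiso ((hF _ h1).resolve_right h2) h2
  · rw [sum_dualCount]; exact hR.iterate_succ_dualInt_length hF hP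
  · intro i j hi hj hij
    rw [sum_dualCount] at hi hj
    rw [hR.iterate_succ_dualInt hF hP hi, hR.iterate_succ_dualInt hF hP hj] at hij
    exact (List.Nodup.getElem_inj_iff (hR.nodup_walkedList le_rfl)).1 (dualDart_injective hij)
  · rintro ⟨g, k'⟩ ⟨hg, hgk⟩
    have k4 : ∀ k : Fin 4, k + 1 + 3 = k := by decide
    have hgf : InF E g := mem_faces.1 (verts_dualInt_subset_faces hg)
    -- the arrow with left square `g` crossing to `g + e_{k'}`
    set a : Site 2 × Fin 4 := (corner g (k' + 1), k' + 1) with ha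
    have h1 : aedge a ∈ E := hgf.side_mem (k' + 1)
    have hrsq : rsq a = g + dir k' := by
      rw [ha, rsq_mk, ← quad_add_dir_add_three, quad_corner, k4]
    have h2 : ¬ InF E (rsq a) := by
      intro h
      rw [hrsq] at h
      exact hgk (mem_dualInt_of_faces (mem_faces.2 hgf) (mem_faces.2 h))
    obtain ⟨t, ht, hta⟩ := List.getElem_of_mem (hR.mem_walkedList h1 h2)
    refine ⟨t, by rwa [sum_dualCount], ?_⟩
    rw [hR.iterate_succ_dualInt hF hP ht, hta, ha]
    simp [dualDart, k4]

/-! ### The arcs of the dual rectangle -/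

/-- Membership in the arrows walked by `m` consecutive darts from position `i₀` of the boundary cycle.
[folklore] -/
theorem mem_walkedList_iterate_iff {d₀ a : Site 2 × Fin 4} {i₀ m : ℕ} :
    a ∈ walkedList E ((succ E)^[i₀] d₀) m ↔ ∃ i, i₀ ≤ i ∧ i < i₀ + m ∧ a ∈ slots E ((succ E)^[i] d₀) := by
  rw [mem_walkedList_iff]
  constructor
  · rintro ⟨i', hi', h⟩
    refine ⟨i₀ + i', by omega, by omega, ?_⟩
    rwa [mem_slotList_iff, ← Function.iterate_add_apply, Nat.add_comm] at h
  · rintro ⟨i, h1, h2, h⟩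
    refine ⟨i - i₀, by omega, ?_⟩
    rw [mem_slotList_iff, ← Function.iterate_add_apply, Nat.sub_add_cancel h1]
    exact h

/-- Splitting one period of walked arrows at arc `j`: before, on, and after the arc. [folklore] -/
theorem walkedList_split (d₀ : Site 2 × Fin 4) (n : Fin 4 → ℕ) (j : Fin 4) :
    walkedList E d₀ (n 0 + n 1 + n 2 + n 3) =
      walkedList E d₀ (lo n j) ++ (walkedList E ((succ E)^[lo n j] d₀) (n j) ++
        walkedList E ((succ E)^[lo n j + n j] d₀) (n 0 + n 1 + n 2 + n 3 - (lo n j + n j))) := by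
  conv_lhs => rw [show n 0 + n 1 + n 2 + n 3 = lo n j + (n j + (n 0 + n 1 + n 2 + n 3 - (lo n j + n j))) by
    have := lo_add_le n j; omega]
  rw [walkedList_add, walkedList_add, ← Function.iterate_add_apply, Nat.add_comm (n j)]

/-- **Positions on the dual arcs, I**: a dart of the dual cycle at a position of dual arc `j` is the dual dart of
an arrow walked by a dart of arc `j`. [folklore] -/
theorem IsRect.exists_mem_walkedList_of_mem_arc (hR : IsRect E d₀ n) (hF : IsFaceDomain E)
    (hP : ∀ q, NoPinchAt E q) {j : Fin 4} {t : ℕ} (h1 : lo (dualCount E d₀ n) j ≤ t)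
    (h2 : t < lo (dualCount E d₀ n) j + dualCount E d₀ n j) :
    ∃ a ∈ walkedList E ((succ E)^[lo n j] d₀) (n j),
      (succ (dualInt E))^[t] (dualDart (firstArrow E d₀)) = dualDart a := by
  rw [lo_dualCount] at h1 h2
  unfold dualCount at h2
  obtain ⟨s, rfl⟩ := Nat.exists_eq_add_of_le h1
  have hs : s < (walkedList E ((succ E)^[lo n j] d₀) (n j)).length := by omega
  have ht : (walkedList E d₀ (lo n j)).length + s < (walkedList E d₀ (n 0 + n 1 + n 2 + n 3)).length := by
    have := lo_add_le (dualCount E d₀ n) j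
    rw [sum_dualCount, lo_dualCount] at this
    unfold dualCount at this
    omega
  refine ⟨(walkedList E ((succ E)^[lo n j] d₀) (n j))[s], List.getElem_mem _, ?_⟩
  rw [hR.iterate_succ_dualInt hF hP ht]
  congr 1
  apply Option.some.inj
  rw [← List.getElem?_eq_getElem, ← List.getElem?_eq_getElem, walkedList_split d₀ n j,
    List.getElem?_append_right (by omega), Nat.add_sub_cancel_left, List.getElem?_append_left hs]

/-- **Positions on the dual arcs, II**: the dual dart of an arrow walked by a dart of arc `j` is a dart of the
dual cycle at a position of dual arc `j`. [folklore] -/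
theorem IsRect.exists_iterate_eq_of_mem_slots (hR : IsRect E d₀ n) (hF : IsFaceDomain E)
    (hP : ∀ q, NoPinchAt E q) {j : Fin 4} {i : ℕ} (h1 : lo n j ≤ i) (h2 : i < lo n j + n j)
    {a : Site 2 × Fin 4} (ha : a ∈ slots E ((succ E)^[i] d₀)) :
    ∃ t, lo (dualCount E d₀ n) j ≤ t ∧ t < lo (dualCount E d₀ n) j + dualCount E d₀ n j ∧
      (succ (dualInt E))^[t] (dualDart (firstArrow E d₀)) = dualDart a := by
  obtain ⟨s, hs, hsa⟩ := List.getElem_of_mem (mem_walkedList_iterate_iff.2 ⟨i, h1, h2, ha⟩)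
  have ht : (walkedList E d₀ (lo n j)).length + s < (walkedList E d₀ (n 0 + n 1 + n 2 + n 3)).length := by
    have := lo_add_le (dualCount E d₀ n) j
    rw [sum_dualCount, lo_dualCount] at this
    unfold dualCount at this
    omega
  refine ⟨(walkedList E d₀ (lo n j)).length + s, ?_, ?_, ?_⟩
  · rw [lo_dualCount]; omega
  · rw [lo_dualCount]; unfold dualCount; omega
  · rw [hR.iterate_succ_dualInt hF hP ht, ← hsa]
    congr 1
    apply Option.some.inj
    rw [← List.getElem?_eq_getElem, ← List.getElem?_eq_getElem, walkedList_split d₀ n j,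
      List.getElem?_append_right (by omega), Nat.add_sub_cancel_left, List.getElem?_append_left hs]

/-- **The external arcs of the dual rectangle** are the external vertices of the dual darts of the arrows walked
by the corresponding arcs of `Ω` (CDH16 §3.3: the dual arcs `(a* b*), (b* c*), …` of `Ω*`).
[cite: ChelkakDuminilCopinHongler2016, §3.3] -/
theorem IsRect.extArc_dual (hR : IsRect E d₀ n) (hF : IsFaceDomain E) (hP : ∀ q, NoPinchAt E q) (j : Fin 4) :
    extArc (dualInt E) (dualDart (firstArrow E d₀)) (dualCount E d₀ n) j =
      {v | ∃ i, lo n j ≤ i ∧ i < lo n j + n j ∧ ∃ a ∈ slots E ((succ E)^[i] d₀), v = .inr (dualDart a)} := by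
  ext v
  simp only [extArc, Set.mem_setOf_eq]
  constructor
  · rintro ⟨t, h1, h2, rfl⟩
    obtain ⟨a, ha, he⟩ := hR.exists_mem_walkedList_of_mem_arc hF hP h1 h2
    obtain ⟨i, hi1, hi2, hai⟩ := mem_walkedList_iterate_iff.1 ha
    exact ⟨i, hi1, hi2, a, hai, by rw [he]⟩
  · rintro ⟨i, hi1, hi2, a, ha, rfl⟩
    obtain ⟨t, h1, h2, he⟩ := hR.exists_iterate_eq_of_mem_slots hF hP hi1 hi2 ha
    exact ⟨t, h1, h2, by rw [he]⟩

/-- **The vertex arcs of the dual rectangle** are the left squares (faces of `Ω`) of the arrows walked by the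
corresponding arcs of `Ω`. [cite: ChelkakDuminilCopinHongler2016, §3.3] -/
theorem IsRect.arcVerts_dual (hR : IsRect E d₀ n) (hF : IsFaceDomain E) (hP : ∀ q, NoPinchAt E q) (j : Fin 4) :
    arcVerts (dualInt E) (dualDart (firstArrow E d₀)) (dualCount E d₀ n) j =
      {f | ∃ i, lo n j ≤ i ∧ i < lo n j + n j ∧ ∃ a ∈ slots E ((succ E)^[i] d₀), lsq a = f} := by
  ext f
  simp only [arcVerts, Set.mem_setOf_eq]
  constructor
  · rintro ⟨t, h1, h2, rfl⟩
    obtain ⟨a, ha, he⟩ := hR.exists_mem_walkedList_of_mem_arc hF hP h1 h2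
    obtain ⟨i, hi1, hi2, hai⟩ := mem_walkedList_iterate_iff.1 ha
    exact ⟨i, hi1, hi2, a, hai, by rw [he]; rfl⟩
  · rintro ⟨i, hi1, hi2, a, ha, rfl⟩
    obtain ⟨t, h1, h2, he⟩ := hR.exists_iterate_eq_of_mem_slots hF hP hi1 hi2 ha
    exact ⟨t, h1, h2, by rw [he]; rfl⟩

end Rect

/-! ### Discharging the side conditions of `IsRect.dual`: neighbouring faces and nonempty dual arcs -/

section SideConditions

variable {d₀ : Site 2 × Fin 4} {n : Fin 4 → ℕ}

/-- The lower-left corner of a square is the square's label. [folklore] -/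
@[simp] theorem corner_zero (s : Site 2) : corner s 0 = s := rfl

/-- The previous corner: `corner s (j + 3) = corner s j + e_{j+1}`. [folklore] -/
theorem corner_add_three (s : Site 2) (j : Fin 4) : corner s (j + 3) = corner s j + dir (j + 1) := by
  have k1 : ∀ j : Fin 4, j + 3 + 1 = j := by decide
  have k2 : ∀ j : Fin 4, j + 3 = j + 1 + 2 := by decide
  have h := corner_add_one s (j + 3)
  rw [k1] at h
  rw [h, add_assoc, k2, dir_add_two, neg_add_cancel, add_zero]

/-- **A face with an edge off its sides at a corner has a neighbouring face** (face domain, no pinch point at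
that corner): the edge is a side of another face at the corner, adjacent to `f` or diagonal — and then a common
neighbour is a face. [folklore] -/
theorem mem_verts_dualInt_of_mem_off_side (hF : IsFaceDomain E) {f : Site 2} (hf : InF E f) {j m : Fin 4}
    (hP : NoPinchAt E (corner f j)) (hm : m = j + 2 ∨ m = j + 3)
    (he : s(corner f j, corner f j + dir m) ∈ E) : f ∈ verts (dualInt E) := by
  have k1 : ∀ j : Fin 4, j + 2 + 3 = j + 1 := by decide
  have k2 : ∀ j : Fin 4, j + 3 + 3 = j + 2 := by decide
  have k3 : ∀ j : Fin 4, j + 3 + 1 = j := by decide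
  set q := corner f j with hq
  have hfq : quad q j = f := by rw [hq, quad_corner]
  -- an adjacent quadrant at `q` is a face
  have hadj : InF E (quad q (j + 1)) ∨ InF E (quad q (j + 3)) := by
    have hside := hF (q, m) he
    rw [lsq_mk, rsq_mk] at hside
    rcases hm with rfl | rfl
    · rcases hside with h | h
      · exact hP j (hfq ▸ hf) h
      · rw [k1] at h; exact Or.inl h
    · rcases hside with h | h
      · exact Or.inr h
      · rw [k2] at h; exact hP j (hfq ▸ hf) h
  -- the adjacent quadrants share a side with `f`
  have e1 : quad q (j + 1) = f + dir (j + 2) := by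
    rw [← hfq, ← quad_add_one_add_dir q j, dir_add_two, add_neg_cancel_right]
  have e3 : quad q (j + 3) = f + dir (j + 3) := by
    have h := quad_add_one_add_dir q (j + 3)
    rw [k3, hfq] at h
    exact h.symm
  rcases hadj with h | h
  · exact mem_verts_of_mem (Sym2.eq_swap.subst <|
      mem_dualInt_of_faces (mem_faces.2 hf) (mem_faces.2 (e1 ▸ h)) : s(f + dir (j + 2), f) ∈ dualInt E)
  · exact mem_verts_of_mem (Sym2.eq_swap.subst <|
      mem_dualInt_of_faces (mem_faces.2 hf) (mem_faces.2 (e3 ▸ h)) : s(f + dir (j + 3), f) ∈ dualInt E)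

/-- **Every face of a rectangle on a face domain without pinch points has a neighbouring face**, as soon as there
are two faces: otherwise all edges at the corners of a face `f` are sides of `f`, the boundary of `f` is closed under
adjacency, and by connectedness every face is `f`. [folklore] -/
theorem IsRect.mem_verts_dualInt (hR : IsRect E d₀ n) (hF : IsFaceDomain E) (hP : ∀ q, NoPinchAt E q)
    (h2 : ∃ g ∈ faces E, ∃ g' ∈ faces E, g ≠ g') {f : Site 2} (hf : f ∈ faces E) : f ∈ verts (dualInt E) := by
  classical
  by_cases hex : ∃ j m : Fin 4, (m = j + 2 ∨ m = j + 3) ∧ s(corner f j, corner f j + dir m) ∈ E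
  · obtain ⟨j, m, hm, he⟩ := hex
    exact mem_verts_dualInt_of_mem_off_side hF (mem_faces.1 hf) (hP _) hm he
  · exfalso
    push Not at hex
    have hfF : InF E f := mem_faces.1 hf
    -- the corner set of `f` is closed under adjacency in `⟨E⟩`
    have hclosed : ∀ x y, (fromEdgeSet (↑E : Set (Sym2 (Site 2)))).Adj x y →
        (∃ j, x = corner f j) → ∃ j, y = corner f j := by
      rintro x y hxy ⟨j, rfl⟩
      have hmem := mem_image_add_dir_of_adj hR.subset_edgeSet hxy
      rw [fromEdgeSet_adj, Finset.mem_coe] at hxy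
      rw [Finset.mem_image] at hmem
      obtain ⟨m, -, rfl⟩ := hmem
      have hm : m = j ∨ m = j + 1 := by
        have h2 := hex j m
        rcases (by fin_cases j <;> fin_cases m <;> simp (config := {decide := true}) :
            m = j ∨ m = j + 1 ∨ m = j + 2 ∨ m = j + 3) with h | h | h | h
        · exact Or.inl h
        · exact Or.inr h
        · exact absurd hxy.1 (h2 (Or.inl h))
        · exact absurd hxy.1 (h2 (Or.inr h))
      rcases hm with h | h
      · exact ⟨j + 1, by rw [h, corner_add_one]⟩
      · exact ⟨j + 3, by rw [h, corner_add_three]⟩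
    have hwalk : ∀ {x y : Site 2} (w : (fromEdgeSet (↑E : Set (Sym2 (Site 2)))).Walk x y),
        (∃ j, x = corner f j) → ∃ j, y = corner f j := by
      intro x y w
      induction w with
      | nil => exact id
      | cons hadj _ ih => exact fun hx ↦ ih (hclosed _ _ hadj hx)
    -- every face is `f`
    have hall : ∀ g ∈ faces E, g = f := by
      intro g hg
      have hgF : InF E g := mem_faces.1 hg
      have hgv : g ∈ verts E := fst_mem_verts_of_aedge_mem (a := (g, 0)) (hgF.side_mem 0)
      have hfv : f ∈ verts E := fst_mem_verts_of_aedge_mem (a := (f, 0)) (hfF.side_mem 0)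
      obtain ⟨w⟩ := hR.reachable hfv hgv
      obtain ⟨j, hj⟩ := hwalk w ⟨0, rfl⟩
      -- the two sides of `g` at its corner `g = corner f j` point in directions `0` and `1`
      have h0 : s(corner f j, corner f j + dir 0) ∈ E := by rw [← hj]; exact hgF.side_mem 0
      have h1 : s(corner f j, corner f j + dir 1) ∈ E := by
        have h := hgF.side_mem 3
        have c3 : corner g 3 = g + dir 1 := rfl
        have e : g + dir 1 + dir 3 = g := by
          rw [add_assoc, show (3 : Fin 4) = 1 + 2 from rfl, dir_add_two, add_neg_cancel, add_zero]
        rw [c3, e, Sym2.eq_swap, hj] at h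
        exact h
      have hj0 : j = 0 := by
        have a0 := hex j 0
        have a1 := hex j 1
        fin_cases j
        · rfl
        · exact absurd h0 (a0 (Or.inr rfl))
        · exact absurd h0 (a0 (Or.inl rfl))
        · exact absurd h1 (a1 (Or.inl rfl))
      rw [hj, hj0]; rfl
    obtain ⟨g, hg, g', hg', hne⟩ := h2
    exact hne ((hall g hg).trans (hall g' hg').symm)

/-- **At most one turn in a row**: of two consecutive darts of the boundary trace of a face domain, one walks an
arrow. [folklore] -/
theorem length_slotList_pos_or (hE : ∀ e ∈ E, e ∈ (zdGraph 2).edgeSet) (hF : IsFaceDomain E)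
    {d : Site 2 × Fin 4} (hd : IsExtDart E d) :
    0 < (slotList E d).length ∨ 0 < (slotList E (succ E d)).length := by
  obtain ⟨x, k⟩ := d
  by_cases h1 : s(x, x + dir (k + 1)) ∈ E
  · left
    unfold slotList; dsimp only; simp only [h1, if_true]; split_ifs <;> simp
  · right
    have k2 : ∀ k : Fin 4, k + 1 + 1 = k + 2 := by decide
    obtain ⟨-, hsucc, -⟩ := firstArrow_of_notMem hE hF hd h1
    have h2 := mem_add_two_of_turn hE hF hd h1
    rw [hsucc]
    unfold slotList; dsimp only; simp only [k2, h2, if_true]; split_ifs <;> simp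

/-- **An arc of at least two darts walks an arrow**: its dual arc is nonempty. [folklore] -/
theorem IsRect.dualCount_pos_of_two_le (hR : IsRect E d₀ n) (hF : IsFaceDomain E) {j : Fin 4} (h2 : 2 ≤ n j) :
    0 < dualCount E d₀ n j := by
  unfold dualCount
  rw [length_walkedList]
  have key := length_slotList_pos_or hR.subset_edgeSet hF (hR.isExtDart_iterate (lo n j))
  have hsub : Finset.range 2 ⊆ Finset.range (n j) := Finset.range_subset_range.2 h2
  refine lt_of_lt_of_le ?_ (Finset.sum_le_sum_of_subset hsub)
  rw [Finset.sum_range_succ, Finset.sum_range_one, Function.iterate_zero_apply, Function.iterate_one]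
  omega

end SideConditions

end DiscreteRect

end Literature.Probability.LatticeModels
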